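import Summits.CriticalPhenomena.SAWScalingLimit.Theses.SAWDevelopingMap
import Summits.CriticalPhenomena.SAWScalingLimit.Theorems.SAWDevelopingMapObservableToSLETargetTransport
import Summits.CriticalPhenomena.SAWScalingLimit.Theorems.SAWDevelopingMapObservableToSLERestrictionCocycleHelpersReal
import Summits.CriticalPhenomena.SAWScalingLimit.Theorems.SAWDevelopingMapObservableToSLERestrictionCocycleHelpersPackage
import Summits.CriticalPhenomena.SAWScalingLimit.Theorems.SAWDevelopingMapObservableToSLERestrictionCocycleHelpersFloor
import Summits.CriticalPhenomena.SAWScalingLimit.Theorems.SAWDevelopingMapObservableToSLECanonicalTransferLimit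
import Literature.Probability.RandomPlanarGeometry.HullSubdomainPullback
import Literature.Probability.RandomPlanarGeometry.ConformalRectangle
import Literature.Probability.RandomPlanarGeometry.RestrictionHulls
import HarnessLib

/-!
# Crux `HexConjecture` (stmt-CriticalPhenomena-0808), line `root-locality-replaces-loewner`:
the admissible restriction limit from the boundary floor-ratio limit

Landing target:
`Summits/CriticalPhenomena/SAWScalingLimit/Theorems/SAWDevelopingMapHexConjectureRestrictionCocycleOfFloorRatio.lean`
(`--supports stmt-CriticalPhenomena-0808`).

Crux stmt-CriticalPhenomena-10472's landed bootstrap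
`ObservableToSLE.FloorRatio.stub_restrictionCocycle : HexObservableLimit → ShortChordLocality →
AdmissibleRestrictionLimit` (file `…ObservableToSLERestrictionCocycle.lean`) uses Duminil-Copin and
Smirnov's Conjecture 2 (`HexObservableLimit`, stmt-CriticalPhenomena-14003) ONLY through the landed
target transport `FloorRatio.stub_targetTransport : HexObservableLimit → FloorRatioLimit`, where
`FloorRatioLimit` is the boundary statement "for a floor domain `D` with marks `a, b` and a second
floor point `b'`, the ratio `F_δ(b'_δ)/F_δ(b_δ)` of the critical parafermionic observable at the two
floor mid-edges tends to `exp ((5/8)(L(b') - L(b)))`, `L = log Φ'` for a half-plane map `Φ : D → ℍ`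
with `Φ(a) = ∞`".  On the floor the observable has a deterministic phase, so `FloorRatioLimit` is a
statement about ratios of critical partition functions `Z_Λ(a → b')/Z_Λ(a → b)` only — it is
observable-free and (a priori) much weaker than Conjecture 2 in the bulk.

This file records the bootstrap with the weaker hypothesis,

* `restrictionCocycle_of_floorRatioLimit : FloorRatioLimit → ShortChordLocality →
  AdmissibleRestrictionLimit`

(all three statements verbatim the tree statements: the conclusion of `stub_targetTransport`, and
the second hypothesis and the conclusion of `stub_restrictionCocycle`), so that the line's
statement 1 can be weakened from Conjecture 2 to the boundary floor-ratio limit.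

## Proof (the bootstrap, after `…ObservableToSLERestrictionCocycle.lean`)

Write `Z_Λ(p, q) = Σ_{γ ⊂ Λ : p → q} x_c^{ℓ(γ)}` and `r_{pq} = Z_{Λ'}(p,q)/Z_Λ(p,q) ∈ [0, 1]` (exact
restriction).  For a floor point `s = a + t` and its lattice approximants `s_δ` (`…HelpersFloor`):
`r_{ab} = r_{as} · [Z_{Λ'}(a,b)/Z_{Λ'}(a,s)] · [Z_Λ(a,s)/Z_Λ(a,b)]`.  The two brackets are moduli of
the ratios `F(s_δ)/F(b_δ)` of the parafermionic observable (deterministic floor-to-floor winding,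
`…HelpersLattice`), which converge by the floor-ratio limit applied to `(D; a; b, s)` with `Λ` and to
`(D'; a; b, s)` with `Λ'` (conformal data `Ψ = -1/φ⁻¹`, `Ψ' = -1/(Φ_A ∘ φ⁻¹)`,
`…HelpersReflection`, `…HelpersPackage`); their quotient tends to
`R(t) = exp((5/8)(Re(Ls - Lb) - Re(L's - L'b)))`, and `R(t) → Φ_A'(0)^{5/8}` as `t → 0⁺`
(coalescence, `…HelpersCoalescence`).  Short-chord locality gives `1 - η ≤ r_{as} ≤ 1` eventually,
for `t` small, and the squeeze `…HelpersReal.tendsto_of_forall_squeeze` concludes.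
Sources: G. F. Lawler, O. Schramm, W. Werner, *Conformal restriction: the chordal case*, J. Amer.
Math. Soc. **16** (2003), Thm 6.1 and §2; G. F. Lawler, O. Schramm, W. Werner, *On the scaling
limit of planar self-avoiding walk*, Proc. Sympos. Pure Math. **72.2** (2004), §3.4 and Prop. 2;
H. Duminil-Copin, S. Smirnov, Ann. of Math. **175** (2012), Lemma 2.
-/

noncomputable section

open scoped BigOperators Topology NNReal ENNReal Classical
open Filter Set MeasureTheory Metric
open Literature.Probability.LatticeModels (HexVertex hexGraph hexCenter Site)
open Literature.Probability.RandomPlanarGeometry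
open Literature.Probability.RandomPlanarGeometry.SAW
open UpperHalfPlane (upperHalfPlaneSet)
open Summit.CriticalPhenomena.SAWScalingLimit.Theorems.ObservableToSLE.FloorRatio

namespace Summit.CriticalPhenomena.SAWScalingLimit.Theorems.HexConjecture.RootLocality

/-- The quotient of the moduli of `exp ((5/8) u)` and `exp ((5/8) w)` is
`exp ((5/8) (re u - re w))` (the modulus function `R` of the bootstrap). [folklore] -/
theorem norm_exp_five_eighths_div : ∀ u w : ℂ,
    ‖Complex.exp ((5 / 8 : ℂ) * u)‖ / ‖Complex.exp ((5 / 8 : ℂ) * w)‖ =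
      Real.exp ((5 / 8) * (u.re - w.re)) := by
  intro u w
  rw [Complex.norm_exp, Complex.norm_exp, ← Real.exp_sub]
  congr 1
  simp [Complex.mul_re]
  ring

/-- **The restriction cocycle from the boundary floor-ratio limit** —
`FloorRatioLimit → ShortChordLocality → AdmissibleRestrictionLimit`.  For nested admissible
families `Λ' δ ⊆ Λ δ` of a floor domain `D` and a hull subdomain `D' = φ(ℍ ∖ A)`, the ratio of
critical partition functions `Z_{Λ' δ}(a δ → b δ)/Z_{Λ δ}(a δ → b δ)` tends to `Φ_A'(0)^{5/8}` —
the Lawler–Schramm–Werner restriction exponent of `SLE(8/3)` — as soon as the floor ratios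
`F_δ(s_δ)/F_δ(b_δ)` have their conformally covariant limits (first hypothesis, the conclusion of
`FloorRatio.stub_targetTransport`) and short chords are local (second hypothesis).  The proof is
the bootstrap of `FloorRatio.stub_restrictionCocycle` with the target transport replaced by the
hypothesis; see the module docstring.
[cite: LawlerSchrammWerner2004SAW, §3.4 and Prop. 2] -/
theorem restrictionCocycle_of_floorRatioLimit :
    (∀ (D D' : DobrushinDomain) (ρ : ℝ) (Λ : ℝ → Finset HexVertex) (m₀ m m' : ℝ → ℤ)
  (a b b' : ℝ → Sym2 HexVertex) (Φ : ConformalEquiv D.carrier upperHalfPlaneSet)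
  (L : ℂ → ℂ) (Lb Lb' : ℂ),
  D'.carrier = D.carrier → D'.pt 0 = D.pt 0 → 0 < ρ →
  D.carrier ∩ ball (D.pt 0) ρ = {z : ℂ | (D.pt 0).im < z.im} ∩ ball (D.pt 0) ρ →
  D.carrier ∩ ball (D.pt 1) ρ = {z : ℂ | (D.pt 1).im < z.im} ∩ ball (D.pt 1) ρ →
  D.carrier ∩ ball (D'.pt 1) ρ = {z : ℂ | (D'.pt 1).im < z.im} ∩ ball (D'.pt 1) ρ →
  (∀ᶠ δ : ℝ in 𝓝[>] 0,
  hexDomainSimplyConnected (Λ δ) ∧ a δ ∈ hexDomainBoundary (Λ δ) ∧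
  b δ ∈ hexDomainBoundary (Λ δ) ∧ b' δ ∈ hexDomainBoundary (Λ δ) ∧
  Nonempty (HexMidEdgeSAW (Λ δ) (a δ) (b δ)) ∧ Nonempty (HexMidEdgeSAW (Λ δ) (a δ) (b' δ)) ∧
  (hexGraph.induce (↑(Λ δ) : Set HexVertex)).Preconnected ∧
  (∀ v ∈ Λ δ, (δ : ℂ) * hexCenter v ∈ D.carrier) ∧
  (∀ v : HexVertex, (δ : ℂ) * hexCenter v ∈ ball (D.pt 0) ρ → (v ∈ Λ δ ↔ m₀ δ ≤ v.1 1)) ∧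
  (∀ v : HexVertex, (δ : ℂ) * hexCenter v ∈ ball (D.pt 1) ρ → (v ∈ Λ δ ↔ m δ ≤ v.1 1)) ∧
  (∀ v : HexVertex, (δ : ℂ) * hexCenter v ∈ ball (D'.pt 1) ρ → (v ∈ Λ δ ↔ m' δ ≤ v.1 1))) →
  (∀ K : Set ℂ, IsCompact K → K ⊆ D.carrier →
  ∀ᶠ δ : ℝ in 𝓝[>] 0, ∀ v : HexVertex, (δ : ℂ) * hexCenter v ∈ K → v ∈ Λ δ) →
  Tendsto (fun δ : ℝ => (δ : ℂ) * hexMidpoint (a δ)) (𝓝[>] 0) (𝓝 (D.pt 0)) →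
  Tendsto (fun δ : ℝ => (δ : ℂ) * hexMidpoint (b δ)) (𝓝[>] 0) (𝓝 (D.pt 1)) →
  Tendsto (fun δ : ℝ => (δ : ℂ) * hexMidpoint (b' δ)) (𝓝[>] 0) (𝓝 (D'.pt 1)) →
  Tendsto (fun x => ‖Φ x‖) (𝓝[D.carrier] (D.pt 0)) atTop →
  Φ.HasBoundaryValue (D.pt 1) 0 →
  ContinuousOn L D.carrier → (∀ z ∈ D.carrier, Complex.exp (L z) = deriv Φ z) →
  Tendsto L (𝓝[D.carrier] (D.pt 1)) (𝓝 Lb) → Tendsto L (𝓝[D.carrier] (D'.pt 1)) (𝓝 Lb') →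
  Tendsto (fun δ : ℝ =>
      hexParafermionicObservable (Λ δ) (a δ) hexCriticalFugacity (5 / 8) (b' δ) /
        hexParafermionicObservable (Λ δ) (a δ) hexCriticalFugacity (5 / 8) (b δ)) (𝓝[>] 0)
    (𝓝 (Complex.exp ((5 / 8 : ℂ) * (Lb' - Lb))))) →
    (∀ ε : ℝ, 0 < ε → ∃ K : ℝ, 0 < K ∧ ∀ (n : ℕ), 1 ≤ n → ∀ (Λ : Finset HexVertex) (s t : Sym2 HexVertex), hexDomainSimplyConnected Λ → s ∈ hexDomainBoundary Λ → t ∈ hexDomainBoundary Λ → s ≠ t → dist (hexMidpoint s) (hexMidpoint t) ≤ n → (hexMidpoint t).im = (hexMidpoint s).im → (∀ v ∈ Λ, (hexMidpoint s).im < (hexCenter v).im) → (∀ v : HexVertex, (hexMidpoint s).im < (hexCenter v).im → dist (hexCenter v) (hexMidpoint s) ≤ 2 * K * n → v ∈ Λ) → (∑ γ : HexMidEdgeSAW Λ s t, if ∃ v ∈ γ.verts, K * n ≤ dist (hexCenter v) (hexMidpoint s) then hexCriticalFugacity ^ γ.length else 0) ≤ ε * ∑ γ : HexMidEdgeSAW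 Λ s t, hexCriticalFugacity ^ γ.length) →
  ∀ (D D' : DobrushinDomain) (ρ : ℝ) (φ : ConformalEquiv upperHalfPlaneSet D.carrier)
  (Φ : ConformalEquiv (upperHalfPlaneSet \ φ.pullbackHull D') upperHalfPlaneSet) (d : ℝ)
  (Λ Λ' : ℝ → Finset HexVertex) (m : ℝ → ℤ) (a b : ℝ → Sym2 HexVertex),
  (0 < ρ ∧ (D.pt 1).im = (D.pt 0).im ∧ D.carrier ⊆ {z : ℂ | (D.pt 0).im < z.im} ∧
  D.carrier ∩ ball (D.pt 0) ρ = {z : ℂ | (D.pt 0).im < z.im} ∩ ball (D.pt 0) ρ ∧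
  D.carrier ∩ ball (D.pt 1) ρ = {z : ℂ | (D.pt 1).im < z.im} ∩ ball (D.pt 1) ρ) → D.IsHullSubdomain D' → D.IsChordalUniformizing φ →
  IsRestrictionMap (φ.pullbackHull D') Φ → HasRestrictionDeriv (φ.pullbackHull D') Φ d →
  (∀ᶠ δ : ℝ in 𝓝[>] 0,
  Λ' δ ⊆ Λ δ ∧ hexDomainSimplyConnected (Λ δ) ∧ hexDomainSimplyConnected (Λ' δ) ∧
  (hexGraph.induce (↑(Λ δ) : Set HexVertex)).Preconnected ∧
  (hexGraph.induce (↑(Λ' δ) : Set HexVertex)).Preconnected ∧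
  a δ ∈ hexDomainBoundary (Λ δ) ∧ b δ ∈ hexDomainBoundary (Λ δ) ∧
  a δ ∈ hexDomainBoundary (Λ' δ) ∧ b δ ∈ hexDomainBoundary (Λ' δ) ∧
  Nonempty (HexMidEdgeSAW (Λ' δ) (a δ) (b δ)) ∧
  (∀ v ∈ Λ δ, (δ : ℂ) * hexCenter v ∈ D.carrier ∧ m δ ≤ v.1 1) ∧
  (∀ v ∈ Λ' δ, (δ : ℂ) * hexCenter v ∈ D'.carrier) ∧
  (∀ v : HexVertex, (δ : ℂ) * hexCenter v ∈ ball (D.pt 0) ρ ∪ ball (D.pt 1) ρ →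
  ((v ∈ Λ δ ↔ m δ ≤ v.1 1) ∧ (v ∈ Λ' δ ↔ m δ ≤ v.1 1)))) →
  (∀ K : Set ℂ, IsCompact K → K ⊆ D.carrier →
  ∀ᶠ δ : ℝ in 𝓝[>] 0, ∀ v : HexVertex, (δ : ℂ) * hexCenter v ∈ K → v ∈ Λ δ) →
  (∀ K : Set ℂ, IsCompact K → K ⊆ D'.carrier →
  ∀ᶠ δ : ℝ in 𝓝[>] 0, ∀ v : HexVertex, (δ : ℂ) * hexCenter v ∈ K → v ∈ Λ' δ) →
  Tendsto (fun δ : ℝ => (δ : ℂ) * hexMidpoint (a δ)) (𝓝[>] 0) (𝓝 (D.pt 0)) →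
  Tendsto (fun δ : ℝ => (δ : ℂ) * hexMidpoint (b δ)) (𝓝[>] 0) (𝓝 (D.pt 1)) →
  Tendsto (fun δ : ℝ => (∑ γ : HexMidEdgeSAW (Λ' δ) (a δ) (b δ), hexCriticalFugacity ^ γ.length) /
  (∑ γ : HexMidEdgeSAW (Λ δ) (a δ) (b δ), hexCriticalFugacity ^ γ.length)) (𝓝[>] 0)
  (𝓝 (d ^ ((5 : ℝ) / 8))) := by
  intro hFRL hSCL D D' ρ φ Φ d Λ Λ' m a b hfl hD' hφ hΦ hd hev hKΛ hKΛ' ha hb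
  obtain ⟨hρ, -, -, hflat0, hflat1⟩ := hfl
  obtain ⟨Ψ, L, Lb, Ψ', L', L'b, ρ₁, R, hρ₁, hρ₁ρ, hΨinf, hΨb, hLc, hLe, hLb, hΨ'inf, hΨ'b, hL'c,
    hL'e, hL'b, hflat0', hflat1', hfloor, hR⟩ :=
    exists_conformalPackage D D' ρ φ Φ d hρ hflat0 hflat1 hD' hφ hΦ hd
  refine tendsto_of_forall_squeeze fun η hη => ?_
  obtain ⟨K, hK, hSCLK⟩ := hSCL η hη
  -- choice of the floor point `s = a + t`
  obtain ⟨t, ht0, htρ, htK, htR⟩ : ∃ t : ℝ, 0 < t ∧ t < ρ₁ / 4 ∧ 8 * K * t < ρ₁ ∧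
      |R t - d ^ ((5 : ℝ) / 8)| ≤ η := by
    have h1 : ∀ᶠ t in 𝓝[>] (0 : ℝ), t < ρ₁ / 4 := mem_nhdsWithin_of_mem_nhds (Iio_mem_nhds (by positivity))
    have h2 : ∀ᶠ t in 𝓝[>] (0 : ℝ), 8 * K * t < ρ₁ := by
      have hc : Tendsto (fun t : ℝ => 8 * K * t) (𝓝 0) (𝓝 (8 * K * 0)) :=
        (continuous_const.mul continuous_id).tendsto 0
      rw [mul_zero] at hc
      exact mem_nhdsWithin_of_mem_nhds (hc (Iio_mem_nhds hρ₁))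
    have h3 : ∀ᶠ t in 𝓝[>] (0 : ℝ), |R t - d ^ ((5 : ℝ) / 8)| ≤ η := by
      filter_upwards [Metric.tendsto_nhds.1 hR η hη] with t ht
      rw [Real.dist_eq] at ht
      exact ht.le
    obtain ⟨t, ⟨h1t, h2t, h3t⟩, ht0⟩ := ((h1.and (h2.and h3)).and self_mem_nhdsWithin).exists
    exact ⟨t, ht0, h1t, h2t, h3t⟩
  obtain ⟨hsfr, hsfr', hsa, Ls, L's, hLs, hL's, hRt⟩ := hfloor t ht0 (by linarith)
  set s : ℂ := D.pt 0 + t with hs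
  have hsim : s.im = (D.pt 0).im := by simp [hs]
  have hdist_s : dist s (D.pt 0) = t := by
    rw [hs, dist_eq_norm, add_sub_cancel_left, Complex.norm_real, Real.norm_eq_abs, abs_of_pos ht0]
  -- the lattice floor data
  obtain ⟨sE, n, hsE, hevF⟩ := floorData D D' ρ Λ Λ' m a b hρ hev ha hb hsa hsim
    (by rw [hdist_s]; linarith) hK (by rw [hdist_s]; linarith)
  -- re-marked domains `(D; a, s)`, `(D'; a, s)`
  obtain ⟨Ds, hDs_car, hDs0, hDs1⟩ := exists_remark D hsfr hsa
  obtain ⟨D's, hD's_car, hD's0, hD's1⟩ := exists_remark D' hsfr' (by rw [hD'.pt_zero_eq]; exact hsa)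
  -- the transport radius `ρ₂ = ρ₁/2` and flatness
  have hsub : D'.carrier ⊆ D.carrier := hD'.carrier_subset
  have hballs : ball s (ρ₁ / 2) ⊆ ball (D.pt 0) ρ₁ := by
    intro z hz
    rw [mem_ball] at hz ⊢
    calc dist z (D.pt 0) ≤ dist z s + dist s (D.pt 0) := dist_triangle _ _ _
      _ < ρ₁ / 2 + t := by rw [hdist_s]; linarith
      _ ≤ ρ₁ := by linarith
  have hballsρ : ball s (ρ₁ / 2) ⊆ ball (D.pt 0) ρ := hballs.trans (ball_subset_ball hρ₁ρ)
  have hρ₂ρ : ρ₁ / 2 ≤ ρ := by linarith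
  have hf0 := flat_of_subset hflat0 (ball_subset_ball hρ₂ρ) rfl
  have hf1 := flat_of_subset hflat1 (ball_subset_ball hρ₂ρ) rfl
  have hfs := flat_of_subset hflat0 hballsρ hsim
  have hf0' := flat_of_subset hflat0' (ball_subset_ball (by linarith : ρ₁ / 2 ≤ ρ₁)) rfl
  have hf1' := flat_of_subset hflat1' (ball_subset_ball (by linarith : ρ₁ / 2 ≤ ρ₁)) rfl
  have hfs' := flat_of_subset hflat0' hballs hsim
  -- target transport in `(D; a; b, s)` with `Λ`
  have T₁ : Tendsto (fun δ : ℝ =>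
      hexParafermionicObservable (Λ δ) (a δ) hexCriticalFugacity (5 / 8) (sE δ) /
        hexParafermionicObservable (Λ δ) (a δ) hexCriticalFugacity (5 / 8) (b δ)) (𝓝[>] 0)
      (𝓝 (Complex.exp ((5 / 8 : ℂ) * (Ls - Lb)))) := by
    refine hFRL D Ds (ρ₁ / 2) Λ m m m a b sE Ψ L Lb Ls hDs_car hDs0
      (half_pos hρ₁) hf0 hf1 (by rw [hDs1]; exact hfs) ?_ hKΛ ha hb (by rw [hDs1]; exact hsE)
      hΨinf hΨb hLc hLe hLb (by rw [hDs1]; exact hLs)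
    filter_upwards [hev, hevF] with δ hevδ hF
    obtain ⟨-, hscΛ, -, hconn, -, haΛ, hbΛ, -, -, -, hΛD, -, hrows⟩ := hevδ
    obtain ⟨x, x', yy, -, -, -, -, -, -, -, -, -, -, -, hsEbd, -, hne_ab, hne_as, -⟩ := hF
    refine ⟨hscΛ, haΛ, hbΛ, hsEbd, hne_ab, hne_as, hconn, fun v hv => (hΛD v hv).1, ?_, ?_, ?_⟩
    · exact fun v hv => (hrows v (Or.inl (ball_subset_ball hρ₂ρ hv))).1
    · exact fun v hv => (hrows v (Or.inr (ball_subset_ball hρ₂ρ hv))).1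
    · intro v hv
      rw [hDs1] at hv
      exact (hrows v (Or.inl (hballsρ hv))).1
  -- target transport in `(D'; a; b, s)` with `Λ'`
  have T₂ : Tendsto (fun δ : ℝ =>
      hexParafermionicObservable (Λ' δ) (a δ) hexCriticalFugacity (5 / 8) (sE δ) /
        hexParafermionicObservable (Λ' δ) (a δ) hexCriticalFugacity (5 / 8) (b δ)) (𝓝[>] 0)
      (𝓝 (Complex.exp ((5 / 8 : ℂ) * (L's - L'b)))) := by
    refine hFRL D' D's (ρ₁ / 2) Λ' m m m a b sE Ψ' L' L'b L's hD's_car hD's0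
      (half_pos hρ₁) (by rw [hD'.pt_zero_eq]; exact hf0') (by rw [hD'.pt_one_eq]; exact hf1')
      (by rw [hD's1]; exact hfs') ?_ hKΛ' (by rw [hD'.pt_zero_eq]; exact ha)
      (by rw [hD'.pt_one_eq]; exact hb) (by rw [hD's1]; exact hsE)
      (by rw [hD'.pt_zero_eq]; exact hΨ'inf) (by rw [hD'.pt_one_eq]; exact hΨ'b) hL'c hL'e
      (by rw [hD'.pt_one_eq]; exact hL'b) (by rw [hD's1]; exact hL's)
    filter_upwards [hev, hevF] with δ hevδ hF
    obtain ⟨-, -, hscΛ', -, hconn', -, -, haΛ', hbΛ', hne', -, hΛ'D', hrows⟩ := hevδ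
    obtain ⟨x, x', yy, -, -, -, -, -, -, -, -, -, -, -, -, hsEbd', -, -, hne_as', -⟩ := hF
    refine ⟨hscΛ', haΛ', hbΛ', hsEbd', hne', hne_as', hconn', hΛ'D', ?_, ?_, ?_⟩
    · intro v hv
      rw [hD'.pt_zero_eq] at hv
      exact (hrows v (Or.inl (ball_subset_ball hρ₂ρ hv))).2
    · intro v hv
      rw [hD'.pt_one_eq] at hv
      exact (hrows v (Or.inr (ball_subset_ball hρ₂ρ hv))).2
    · intro v hv
      rw [hD's1] at hv
      exact (hrows v (Or.inl (hballsρ hv))).2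
  -- the squeeze data: `r = Z'(a,s)/Z(a,s)`, `Q = [Z'(a,b)/Z'(a,s)] · [Z(a,s)/Z(a,b)]`, `R = R t`
  refine ⟨fun δ => (∑ γ : HexMidEdgeSAW (Λ' δ) (a δ) (sE δ), hexCriticalFugacity ^ γ.length) /
      (∑ γ : HexMidEdgeSAW (Λ δ) (a δ) (sE δ), hexCriticalFugacity ^ γ.length),
    fun δ => ((∑ γ : HexMidEdgeSAW (Λ' δ) (a δ) (b δ), hexCriticalFugacity ^ γ.length) /
      (∑ γ : HexMidEdgeSAW (Λ' δ) (a δ) (sE δ), hexCriticalFugacity ^ γ.length)) *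
      ((∑ γ : HexMidEdgeSAW (Λ δ) (a δ) (sE δ), hexCriticalFugacity ^ γ.length) /
      (∑ γ : HexMidEdgeSAW (Λ δ) (a δ) (b δ), hexCriticalFugacity ^ γ.length)),
    R t, htR, ?_, ?_⟩
  · -- `Q → R t`: `Q` is the quotient of the moduli of the two transported ratios
    have hA₂ : ‖Complex.exp ((5 / 8 : ℂ) * (L's - L'b))‖ ≠ 0 := norm_ne_zero_iff.2 (Complex.exp_ne_zero _)
    have hlim := (T₁.norm).div (T₂.norm) hA₂
    have hval : ‖Complex.exp ((5 / 8 : ℂ) * (Ls - Lb))‖ / ‖Complex.exp ((5 / 8 : ℂ) * (L's - L'b))‖ = R t := by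
      rw [norm_exp_five_eighths_div, ← hRt]
    rw [hval] at hlim
    refine hlim.congr' ?_
    filter_upwards [hevF] with δ hF
    obtain ⟨x, x', yy, hx1, hx'1, hyy1, hx'x, hyyx, hax, hbx, hsEx, -, hrowsΛ, hrowsΛ', -, -, -,
      hne_as, hne_as', -⟩ := hF
    have h1 := norm_hexParafermionicObservable_floorEdge (Λ δ) x yy hrowsΛ (hyy1.trans hx1.symm) hyyx
    have h2 := norm_hexParafermionicObservable_floorEdge (Λ δ) x x' hrowsΛ (hx'1.trans hx1.symm) hx'x
    have h3 := norm_hexParafermionicObservable_floorEdge (Λ' δ) x yy hrowsΛ' (hyy1.trans hx1.symm) hyyx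
    have h4 := norm_hexParafermionicObservable_floorEdge (Λ' δ) x x' hrowsΛ' (hx'1.trans hx1.symm) hx'x
    have hpos1 := sum_pow_length_pos hne_as
    have hpos2 := sum_pow_length_pos hne_as'
    simp only [Pi.div_apply, norm_div]
    rw [hax, hsEx] at hpos1 hpos2
    rw [hax, hbx, hsEx, h1, h2, h3, h4]
    field_simp
  · -- eventually: `f = r · Q` and `1 - η ≤ r ≤ 1`
    filter_upwards [hev, hevF] with δ hevδ hF
    obtain ⟨hsubΛ, hscΛ, -, -, -, haΛ, -, haΛ', -, -, -, -, -⟩ := hevδ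
    obtain ⟨x, x', yy, -, -, -, -, -, -, -, -, hasE, -, -, hsEbd, -, hne_ab, hne_as, hne_as',
      hn1, hndist, himeq, habove, hbox, hnear⟩ := hF
    have hZpos := sum_pow_length_pos hne_as
    have hZ'pos := sum_pow_length_pos hne_as'
    have hZab := sum_pow_length_pos hne_ab
    refine ⟨?_, ?_, ?_⟩
    · field_simp
    · -- short-chord locality: the far mass is small, the near walks live in `Λ'`
      have hfar := hSCLK (n δ) hn1 (Λ δ) (a δ) (sE δ) hscΛ haΛ hsEbd hasE hndist himeq habove hbox
      have hsplit := archMass_le_archMass_add_farMass (t := sE δ) (R := K * n δ)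
        (hexDomainBoundary_subset _ haΛ') hnear
      rw [le_div_iff₀ hZpos]
      linarith
    · exact (div_le_one hZpos).2 (archMass_mono hsubΛ (a δ) (sE δ))

end Summit.CriticalPhenomena.SAWScalingLimit.Theorems.HexConjecture.RootLocality

end
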